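import Summits.AnomalousDissipation.AnomalousDissipation.Theorems.LaminarNeverLoud.Negative.PowerBudget

/-!
# Tier B of the stub plan for `stub_loudCoatDecades` (line `idea-sketch-ideator2`, card `euler-core-coat-readout`),
# crux stmt-AnomalousDissipation-2986 (`MirrorVariety.GalerkinSteadyZerothLaw`): core restriction and single-shell splitting

`STUB-PLAN-stub_loudCoatDecades.md` §2.2 tier B (k1-H0 = k2-H2, k2-H3).  Coefficient-level bookkeeping for the
core clause of the heart (`C = Cfun|modes N` is an exact Euler core at EVERY level `N ≥ K₀`) and for single-shell
cores:

* `eulerCore_restrict` (B1): if `Cfun` is supported in `modes K₀` and its restriction to level `2K₀` is a real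
  solenoidal nonzero zero of the unforced inviscid Galerkin field, then so is its restriction to every level
  `N ≥ K₀` — reality and transversality are pointwise in `k`; the convection symbol
  `convectionCoeff (modes N) Cfun Cfun k` only sees `l, m ∈ supp Cfun ⊆ modes K₀`, so it is level-independent
  (`convectionCoeff_of_support`), vanishes for `|k| > 2K₀` (`|l + m|² ≤ 2(|l|² + |m|²) ≤ (2K₀)²`), and is killed by
  the Leray symbol for `0 < |k| ≤ 2K₀` by the level-`2K₀` identity.  ONE finite identity (cell core `K₀ = 2`, ABC
  `K₀ = 1`) therefore discharges the core clause of `stub_loudCoatDecades` at every `N`;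
* `coat_split` (B3): for a core on ONE shell `|k|² = n₀` and a coat `h ⊥ C` in `ℓ²`, energy AND dissipation of
  `C + h` split, and `dissipation ν C = ν · 4π² n₀ · energy C`.

The closing `stub_loudCoatCoreTools` is the REGISTERED conjunction `B1 ∧ B3`.  (The coat window B2 and the
production identity B4 of the plan are field-level statements and are not in this file.)  References:
Robinson–Rodrigo–Sadowski 2016, §4.1 (4.5) (Fourier–Galerkin system); the plan and sketch
`Cruxes/GalerkinSteadyZerothLaw/STUB-PLAN-stub_loudCoatDecades.md`, `StubPlanLoudCoatDecadesSketch.lean`.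
-/

noncomputable section

-- `Summit.<Summit>.<Problem>` is the tree's mandated summit-side namespace (CONVENTIONS §2); deliberate duplicate.
set_option linter.dupNamespace false

open scoped InnerProductSpace
open MeasureTheory Filter Set
open Literature.Analysis.FunctionSpaces Literature.Analysis.FunctionSpaces.Torus
open Literature.Analysis.FluidPDE Literature.Analysis.FluidPDE.Torus

namespace Summit.AnomalousDissipation.AnomalousDissipation.Theorems.GalerkinSteadyZerothLaw

open Summit.AnomalousDissipation.AnomalousDissipation.Theorems.LaminarNeverLoud.Negative
  (modes energy dissipation modes_symm freqNormSq_le_of_mem_modes)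

/-! ## §0 Lattice and convection-symbol bookkeeping -/

/-- Parallelogram-type bound on the lattice: `|l + m|² ≤ 2 (|l|² + |m|²)`. [folklore] -/
theorem freqNormSq_add_le (l m : Fin 3 → ℤ) : freqNormSq (l + m) ≤ 2 * (freqNormSq l + freqNormSq m) := by
  unfold freqNormSq
  rw [← Finset.sum_add_distrib, Finset.mul_sum]
  refine Finset.sum_le_sum fun i _ => ?_
  simp only [Pi.add_apply, Int.cast_add]
  nlinarith [sq_nonneg ((l i : ℝ) - m i)]

/-- The punctured balls are nested. [folklore] -/
theorem modes_mono {M M' : ℕ} (h : M ≤ M') : modes (Fin 3) M ⊆ modes (Fin 3) M' := fun k hk => by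
  rw [Finset.mem_erase] at hk ⊢
  exact ⟨hk.1, freqBall_mono h hk.2⟩

/-- **Support restriction of the convection symbol.**  If both coefficient families vanish off `T ⊆ S`, the
convection symbol over `S` equals the one over `T` (every other term has a zero factor). [folklore] -/
theorem convectionCoeff_of_support {S T : Finset (Fin 3 → ℤ)} (hTS : T ⊆ S)
    {C C' : (Fin 3 → ℤ) → EuclideanSpace ℂ (Fin 3)} (hC : ∀ k ∉ T, C k = 0) (hC' : ∀ k ∉ T, C' k = 0)
    (k : Fin 3 → ℤ) : convectionCoeff S C C' k = convectionCoeff T C C' k := by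
  rw [convectionCoeff_def, convectionCoeff_def]
  have hinner : ∀ l, (∑ m ∈ S, if l + m = k then (2 * Real.pi * Complex.I * ∑ j, C l j * (m j : ℂ)) • C' m else 0) =
      ∑ m ∈ T, if l + m = k then (2 * Real.pi * Complex.I * ∑ j, C l j * (m j : ℂ)) • C' m else 0 := by
    intro l
    symm
    refine Finset.sum_subset hTS fun m _ hm => ?_
    rw [hC' m hm, smul_zero, ite_self]
  simp_rw [hinner]
  symm
  refine Finset.sum_subset hTS fun l _ hl => ?_
  refine Finset.sum_eq_zero fun m _ => ?_
  rw [hC l hl]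
  simp

/-! ## §1 B1: the core clause at every level from one finite identity -/

/-- **B1 `eulerCore_restrict`.**  If `Cfun` is supported in `modes K₀` and its restriction to level `2K₀` is a real
solenoidal nonzero zero of the unforced inviscid Galerkin field (`galerkinRHS (modes 2K₀) 0 0 C = 0`), then so is
its restriction to every level `N ≥ K₀`: reality/transversality are pointwise in `k`; the convection symbol is
level-independent (`convectionCoeff_of_support`), vanishes for `|k| > 2K₀` (`freqNormSq_add_le`), and is killed by
the Leray symbol for `0 < |k| ≤ 2K₀` by the level-`2K₀` identity. [folklore] -/
theorem eulerCore_restrict {K₀ : ℕ} {Cfun : (Fin 3 → ℤ) → EuclideanSpace ℂ (Fin 3)}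
    (hsupp : ∀ k ∉ modes (Fin 3) K₀, Cfun k = 0)
    (hcore : (fun k : ↥(modes (Fin 3) (2 * K₀)) => Cfun k) ∈ galerkinSubspace (modes (Fin 3) (2 * K₀)) ∧
      (fun k : ↥(modes (Fin 3) (2 * K₀)) => Cfun k) ≠ 0 ∧
      galerkinRHS (modes (Fin 3) (2 * K₀)) 0 0 (fun k : ↥(modes (Fin 3) (2 * K₀)) => Cfun k) = 0)
    {N : ℕ} (hN : K₀ ≤ N) :
    (fun k : ↥(modes (Fin 3) N) => Cfun k) ∈ galerkinSubspace (modes (Fin 3) N) ∧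
      (fun k : ↥(modes (Fin 3) N) => Cfun k) ≠ 0 ∧
      galerkinRHS (modes (Fin 3) N) 0 0 (fun k : ↥(modes (Fin 3) N) => Cfun k) = 0 := by
  obtain ⟨⟨hreal, hsol⟩, hne, heq⟩ := hcore
  have hK2 : K₀ ≤ 2 * K₀ := by omega
  -- zero extensions of the restrictions are `Cfun`
  have hext : ∀ {M : ℕ}, K₀ ≤ M →
      coeffExt (modes (Fin 3) M) (fun k : ↥(modes (Fin 3) M) => Cfun k) = Cfun := by
    intro M hM
    funext k
    by_cases hk : k ∈ modes (Fin 3) M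
    · rw [coeffExt_of_mem _ hk]
    · rw [coeffExt_of_not_mem _ hk, hsupp k fun hk' => hk (modes_mono hM hk')]
  -- conjugate symmetry and transversality of the family itself
  have hconj : IsConjSymm Cfun := by
    have h := hreal.isConjSymm_coeffExt (modes_symm (2 * K₀))
    rwa [hext hK2] at h
  have htrans : ∀ k : Fin 3 → ℤ, ∑ j, ((k j : ℤ) : ℂ) * Cfun k j = 0 := by
    intro k
    by_cases hk : k ∈ modes (Fin 3) (2 * K₀)
    · exact hsol ⟨k, hk⟩
    · rw [hsupp k fun hk' => hk (modes_mono hK2 hk')]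
      simp
  -- the unforced inviscid field of a restriction, unfolded: `Π_k (-B(Cfun, Cfun)_k)` with the LEVEL-`K₀` symbol
  have hunf : ∀ {M : ℕ} (hM : K₀ ≤ M) (k : ↥(modes (Fin 3) M)),
      galerkinRHS (modes (Fin 3) M) 0 0 (fun k : ↥(modes (Fin 3) M) => Cfun k) k =
        leraySym (k : Fin 3 → ℤ) (-convectionCoeff (modes (Fin 3) K₀) Cfun Cfun (k : Fin 3 → ℤ)) := by
    intro M hM k
    rw [galerkinRHS_apply, galerkinField_def, coeffExt_zero, hext hM,
      convectionCoeff_of_support (modes_mono hM) hsupp hsupp]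
    simp only [zero_mul, Complex.ofReal_zero, zero_smul, neg_zero, zero_add, Pi.zero_apply, zero_sub]
  refine ⟨⟨isRealCoeff_restrict hconj, fun k => htrans k⟩, ?_, ?_⟩
  · -- nonzero: a nonzero coefficient at level `2K₀` lives in `modes K₀ ⊆ modes N`
    intro h0
    apply hne
    funext k
    show Cfun k = 0
    by_cases hk : (k : Fin 3 → ℤ) ∈ modes (Fin 3) K₀
    · exact congrFun h0 ⟨k, modes_mono hN hk⟩
    · exact hsupp k hk
  · -- the Euler equation at level `N`
    funext k
    rw [hunf hN k, Pi.zero_apply]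
    by_cases hk2 : (k : Fin 3 → ℤ) ∈ modes (Fin 3) (2 * K₀)
    · -- `0 < |k| ≤ 2K₀`: the level-`2K₀` identity
      have h := congrFun heq ⟨k, hk2⟩
      rw [hunf hK2, Pi.zero_apply] at h
      exact h
    · -- `|k| > 2K₀`: no pair of supported frequencies sums to `k`
      have hB : convectionCoeff (modes (Fin 3) K₀) Cfun Cfun (k : Fin 3 → ℤ) = 0 := by
        rw [convectionCoeff_def]
        refine Finset.sum_eq_zero fun l hl => Finset.sum_eq_zero fun m hm => ?_
        rw [if_neg]
        intro hlm
        apply hk2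
        rw [Finset.mem_erase]
        refine ⟨(Finset.mem_erase.1 k.2).1, ?_⟩
        rw [← hlm, mem_freqBall]
        have hl' := freqNormSq_le_of_mem_modes hl
        have hm' := freqNormSq_le_of_mem_modes hm
        calc freqNormSq (l + m) ≤ 2 * (freqNormSq l + freqNormSq m) := freqNormSq_add_le l m
          _ ≤ 2 * ((K₀ : ℝ) ^ 2 + (K₀ : ℝ) ^ 2) := by gcongr
          _ = ((2 * K₀ : ℕ) : ℝ) ^ 2 := by push_cast; ring
      rw [hB, neg_zero, leraySym_zero]

/-! ## §2 B3: single-shell splitting -/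

/-- **B3 `coat_split`** (coefficient algebra, SINGLE-SHELL core).  If the core lives on one shell `|k|² = n₀` and
`h ⊥ C` in `ℓ²` (`∑ Re⟪C k, h k⟫ = 0`), then `h ⊥ C` in `ḣ¹` too, so energy AND dissipation of `C + h` split, and
`dissipation ν C = ν · 4π² n₀ · energy C`. [folklore] -/
theorem coat_split {N : ℕ} {n₀ : ℝ} {C h : ↥(modes (Fin 3) N) → EuclideanSpace ℂ (Fin 3)}
    (hshell : ∀ k : ↥(modes (Fin 3) N), C k ≠ 0 → freqNormSq (k : Fin 3 → ℤ) = n₀)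
    (horth : (∑ k, (inner ℂ (C k) (h k)).re) = 0) (ν : ℝ) :
    energy (C + h) = energy C + energy h ∧
      dissipation ν (C + h) = dissipation ν C + dissipation ν h ∧
      dissipation ν C = ν * (4 * Real.pi ^ 2 * n₀) * energy C := by
  -- pointwise expansion of `‖C k + h k‖²`
  have hsq : ∀ k : ↥(modes (Fin 3) N), ‖(C + h) k‖ ^ 2 = ‖C k‖ ^ 2 + 2 * (inner ℂ (C k) (h k)).re + ‖h k‖ ^ 2 := by
    intro k
    rw [Pi.add_apply]
    exact norm_add_sq (𝕜 := ℂ) (C k) (h k)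
  -- on the shell, `|k|²` may be replaced by `n₀` against any quantity vanishing where `C k = 0`
  have hshell_re : ∀ k : ↥(modes (Fin 3) N),
      freqNormSq (k : Fin 3 → ℤ) * (inner ℂ (C k) (h k)).re = n₀ * (inner ℂ (C k) (h k)).re := by
    intro k
    by_cases hk : C k = 0
    · rw [hk, inner_zero_left, Complex.zero_re, mul_zero, mul_zero]
    · rw [hshell k hk]
  have hshell_sq : ∀ k : ↥(modes (Fin 3) N), freqNormSq (k : Fin 3 → ℤ) * ‖C k‖ ^ 2 = n₀ * ‖C k‖ ^ 2 := by
    intro k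
    by_cases hk : C k = 0
    · rw [hk, norm_zero]
      ring
    · rw [hshell k hk]
  have hcrossH : ∑ k : ↥(modes (Fin 3) N), freqNormSq (k : Fin 3 → ℤ) * (inner ℂ (C k) (h k)).re = 0 := by
    rw [Finset.sum_congr rfl fun k _ => hshell_re k, ← Finset.mul_sum, horth, mul_zero]
  refine ⟨?_, ?_, ?_⟩
  · unfold energy
    rw [Finset.sum_congr rfl fun k _ => hsq k, Finset.sum_add_distrib, Finset.sum_add_distrib, ← Finset.mul_sum,
      horth, mul_zero, add_zero]
  · unfold dissipation
    have hexp : ∑ k : ↥(modes (Fin 3) N), freqNormSq (k : Fin 3 → ℤ) * ‖(C + h) k‖ ^ 2 =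
        ∑ k : ↥(modes (Fin 3) N), freqNormSq (k : Fin 3 → ℤ) * ‖C k‖ ^ 2 +
          2 * ∑ k : ↥(modes (Fin 3) N), freqNormSq (k : Fin 3 → ℤ) * (inner ℂ (C k) (h k)).re +
          ∑ k : ↥(modes (Fin 3) N), freqNormSq (k : Fin 3 → ℤ) * ‖h k‖ ^ 2 := by
      rw [Finset.mul_sum, ← Finset.sum_add_distrib, ← Finset.sum_add_distrib]
      refine Finset.sum_congr rfl fun k _ => ?_
      rw [hsq k]
      ring
    rw [hexp, hcrossH, mul_zero, add_zero]
    ring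
  · unfold dissipation energy
    rw [Finset.sum_congr rfl fun k _ => hshell_sq k, ← Finset.mul_sum]
    ring

/-! ## §3 The registered conjunction -/

/-- **stub_loudCoatCoreTools** (REGISTERED sub-goal of the line `idea-sketch-ideator2`: tier B of the stub plan for
`stub_loudCoatDecades`).  The conjunction of B1 `eulerCore_restrict` (the core clause at every level `N ≥ K₀` from
the single identity at level `2K₀`) and B3 `coat_split` (single-shell splitting of energy and dissipation).
[folklore] -/
theorem stub_loudCoatCoreTools : (∀ (K₀ : ℕ) (Cfun : (Fin 3 → ℤ) → EuclideanSpace ℂ (Fin 3)) (N : ℕ), (∀ k ∉ modes (Fin 3) K₀, Cfun k = 0) → ((fun k : ↥(modes (Fin 3) (2 * K₀)) => Cfun k) ∈ galerkinSubspace (modes (Fin 3) (2 * K₀)) ∧ (fun k : ↥(modes (Fin 3) (2 * K₀)) => Cfun k) ≠ 0 ∧ galerkinRHS (modes (Fin 3) (2 * K₀)) 0 0 (fun k : ↥(modes (Fin 3) (2 * K₀)) => Cfun k) = 0) → K₀ ≤ N → (fun k : ↥(modes (Fin 3) N) => Cfun k) ∈ galerkinSubspace (modes (Fin 3) N) ∧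 (fun k : ↥(modes (Fin 3) N) => Cfun k) ≠ 0 ∧ galerkinRHS (modes (Fin 3) N) 0 0 (fun k : ↥(modes (Fin 3) N) => Cfun k) = 0) ∧ (∀ (N : ℕ) (n₀ ν : ℝ) (C h : ↥(modes (Fin 3) N) → EuclideanSpace ℂ (Fin 3)), (∀ k : ↥(modes (Fin 3) N), C k ≠ 0 → freqNormSq (k : Fin 3 → ℤ) = n₀) → (∑ k, (inner ℂ (C k) (h k)).re) = 0 → energy (C + h) = energy C + energy h ∧ dissipation ν (C + h) = dissipation ν C + dissipation ν h ∧ dissipation ν C = ν * (4 * Real.pi ^ 2 * n₀) * energy C) :=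
  ⟨fun _ _ _ hsupp hcore hN => eulerCore_restrict hsupp hcore hN,
    fun _ _ ν _ _ hshell horth => coat_split hshell horth ν⟩

end Summit.AnomalousDissipation.AnomalousDissipation.Theorems.GalerkinSteadyZerothLaw

end
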